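import Mathlib
import HarnessLib

/-!
# Route `ByReductionTypeAtTwo`, crux `RankOneAtTwoOffBigImageOddLocal` (stmt-BirchSwinnertonDyer-23716), line
# `refined_kolyvagin_tamagawa_shift_at_two` — ENGINE PORT `c₀ ↦ h₀` (regular element), §B parity characters of `GL₂(ℤ/2^{M+1})`

Lead prover `prover-cruxlead-stmt-BirchSwinnertonDyer-23716-g0` (2026-08-28), landing the crux-plan g6 ENGINE QUARRY
`Cruxes/RankOneAtTwoOffBigImageOddLocal/RefinedKolyvaginEngineG6.lean` (planner `cruxplan-…-23716-refined-kolyvag-9ff2fe475f-g6`, v4, 1631 lines,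
rc 0 / 0 sorry; `Cruxes/` files are not importable, so the lead COPIES the proofs into `Theorems/` — card «LEAD QUICKSTART (g6)» Q2 #3 / Q4) as
`--supports stmt-BirchSwinnertonDyer-23716` helpers.  The engine port is kernel-closable item #3 of the pen's order (PEN-PICK-23716 ADD-4): replace
complex conjugation `c₀` by a REGULAR element `h₀` (det `−1`, trace `0`, odd mod `2`) in the tree's equivariant-Čebotarev engine
`GenusExact.exists_kolyvaginPrime_gt_two_of_galoisElement`, so that Kolyvagin primes with LOSSLESS local Kummer maps exist on the `Δ > 0` cells of the
S₃-locus (where `ρ̄₂(c₀) = 1` loses the top bit — residual 24883), feeding the line's filtered stubs `…WithOn Φ_reg Ω` (card #7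
`regular-frobenius-kolyvagin-primes-pos-disc`).  THIS FILE: §B — `charGL_eq`: a homomorphism `ψ : GL₂(ℤ/2^{M+1}) → A` (abelian) with `ψ(u)² = 1`, `u = [[1,1],[0,1]]`, restricts to `SL₂` as `1` or `sgn ∘ red₂` according to `ψ(u)` (LDU factorisation `ldu`, relations from conjugation by `J` and `diag(a,1)`); `charGL_eq_one`, `charGL_eq_of_det_eq` (if `ψ(u) = 1`, `ψ` factors through `det`), `charGL_mul_inv_eq`.  Small matrix definitions `redTwo`, `uS`, `lS`, `dS`, `OddModTwo`, `Jmat`, `JGL`, `diagGL` (reviewed defs).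

Statements and proofs are the quarry's VERBATIM (namespace moved to `…Theorems.OffBigImageOddLocalAtTwo.Engine`).  Nothing here proves the crux,
`BSDp W 2`, BSD or the summit; no registered stub is discharged (engine inputs only).  BSD is not proved.

Refs: [GrossLMS1991] §3 (3.1)–(3.3), §9; [McCallumLMS1991] §3; [SilvermanAEC2009] III.§1, III.§8 (Weil pairing), VII–VIII; Dokchitser–Dokchitser (2012);
Serre (1972) §5.3.
-/

set_option linter.dupNamespace false -- tree convention: `Summit.BirchSwinnertonDyer.BirchSwinnertonDyer.Theorems` (summit = sub-problem)
set_option autoImplicit false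

noncomputable section

namespace Summit.BirchSwinnertonDyer.BirchSwinnertonDyer.Theorems.OffBigImageOddLocalAtTwo.Engine

/-! ## §B  Parity characters of `GL₂(ℤ/2^{M+1})`: `ψ|SL₂ ∈ {1, sgn ∘ red₂}` -/

section ParityB

open Matrix
open scoped MatrixGroups Classical

section API
variable {M : ℕ}

/-- reduction mod 2 -/
def redTwo (M : ℕ) : ZMod (2 ^ (M + 1)) →+* ZMod 2 :=
  ZMod.castHom (dvd_pow_self 2 (Nat.succ_ne_zero M)) (ZMod 2)

/-- `redTwo M z` is the residue of the representative `z.val` mod `2`. [folklore] -/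
theorem redTwo_eq_natCast_val (z : ZMod (2 ^ (M + 1))) : redTwo M z = (z.val : ZMod 2) := by
  haveI : NeZero (2 ^ (M + 1)) := ⟨pow_ne_zero _ two_ne_zero⟩
  conv_lhs => rw [← ZMod.natCast_zmod_val z]
  rw [map_natCast]

/-- `z ∈ ℤ/2^{M+1}` is a unit iff its reduction mod `2` is `1`. [folklore] -/
theorem isUnit_iff_redTwo_eq_one (z : ZMod (2 ^ (M + 1))) : IsUnit z ↔ redTwo M z = 1 := by
  haveI : NeZero (2 ^ (M + 1)) := ⟨pow_ne_zero _ two_ne_zero⟩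
  rw [redTwo_eq_natCast_val, ZMod.natCast_eq_one_iff_odd]
  conv_lhs => rw [← ZMod.natCast_zmod_val z]
  rw [ZMod.isUnit_iff_coprime, Nat.coprime_pow_right_iff (Nat.succ_pos M), Nat.coprime_two_right]

/-- `ZMod 2 = {0, 1}`. [folklore] -/
theorem zmod_two_eq_zero_or_one : ∀ t : ZMod 2, t = 0 ∨ t = 1 := by
  decide

/-- `redTwo M z = 0` iff `z` is not a unit. [folklore] -/
theorem redTwo_eq_zero_iff_not_isUnit (z : ZMod (2 ^ (M + 1))) : redTwo M z = 0 ↔ ¬ IsUnit z := by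
  rw [isUnit_iff_redTwo_eq_one]
  rcases zmod_two_eq_zero_or_one (redTwo M z) with h | h <;> simp [h]

end API

section SL

variable {M : ℕ}

/-- `u = [[1,1],[0,1]]` -/
def uS (M : ℕ) : SL(2, ZMod (2 ^ (M + 1))) := ⟨!![1, 1; 0, 1], by simp [Matrix.det_fin_two_of]⟩
/-- `l = [[1,0],[1,1]]` -/
def lS (M : ℕ) : SL(2, ZMod (2 ^ (M + 1))) := ⟨!![1, 0; 1, 1], by simp [Matrix.det_fin_two_of]⟩
/-- `D(a, b) = diag(a, b)` for `a b = 1` -/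
def dS (a b : ZMod (2 ^ (M + 1))) (hab : a * b = 1) : SL(2, ZMod (2 ^ (M + 1))) :=
  ⟨!![a, 0; 0, b], by simp [Matrix.det_fin_two_of, hab]⟩

/-- The matrix of `u` is `[[1,1],[0,1]]`. [folklore] -/
@[simp] theorem coe_uS : ((uS M : SL(2, ZMod (2 ^ (M + 1)))) : Matrix (Fin 2) (Fin 2) (ZMod (2 ^ (M + 1)))) = !![1, 1; 0, 1] := rfl
/-- The matrix of `l` is `[[1,0],[1,1]]`. [folklore] -/
@[simp] theorem coe_lS : ((lS M : SL(2, ZMod (2 ^ (M + 1)))) : Matrix (Fin 2) (Fin 2) (ZMod (2 ^ (M + 1)))) = !![1, 0; 1, 1] := rfl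
/-- The matrix of `diag(a,b)`. [folklore] -/
@[simp] theorem coe_dS (a b : ZMod (2 ^ (M + 1))) (hab : a * b = 1) :
    ((dS a b hab : SL(2, ZMod (2 ^ (M + 1)))) : Matrix (Fin 2) (Fin 2) (ZMod (2 ^ (M + 1)))) = !![a, 0; 0, b] := rfl

/-- The matrix of `u^n` is `[[1,n],[0,1]]`. [folklore] -/
theorem coe_uS_pow (n : ℕ) :
    ((uS M ^ n : SL(2, ZMod (2 ^ (M + 1)))) : Matrix (Fin 2) (Fin 2) (ZMod (2 ^ (M + 1)))) =
      !![1, (n : ZMod (2 ^ (M + 1))); 0, 1] := by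
  induction n with
  | zero => simp [Matrix.one_fin_two]
  | succ n ih =>
    rw [pow_succ (uS M) n, Matrix.SpecialLinearGroup.coe_mul, ih, coe_uS, Matrix.mul_fin_two]
    push_cast
    (congr 1; simp [add_comm])

/-- The matrix of `l^n` is `[[1,0],[n,1]]`. [folklore] -/
theorem coe_lS_pow (n : ℕ) :
    ((lS M ^ n : SL(2, ZMod (2 ^ (M + 1)))) : Matrix (Fin 2) (Fin 2) (ZMod (2 ^ (M + 1)))) =
      !![1, 0; (n : ZMod (2 ^ (M + 1))), 1] := by
  induction n with
  | zero => simp [Matrix.one_fin_two]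
  | succ n ih =>
    rw [pow_succ (lS M) n, Matrix.SpecialLinearGroup.coe_mul, ih, coe_lS, Matrix.mul_fin_two]
    push_cast
    (congr 1; simp [add_comm])

/-- ODD reduction mod 2: `s mod 2` is a transposition of `SL₂(𝔽₂) ≅ S₃` (trace even, not the identity). -/
def OddModTwo (s : SL(2, ZMod (2 ^ (M + 1)))) : Prop :=
  redTwo M (s 0 0 + s 1 1) = 0 ∧ (redTwo M (s 0 1) ≠ 0 ∨ redTwo M (s 1 0) ≠ 0)

/-- LDU: if `s₀₀ b = 1`, then `s = l^{x} · D(s₀₀, b) · u^{y}` with `x = s₁₀ b`, `y = s₀₁ b`. -/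
theorem ldu (s : SL(2, ZMod (2 ^ (M + 1)))) (b : ZMod (2 ^ (M + 1))) (hab : s 0 0 * b = 1) :
    s = lS M ^ (s 1 0 * b).val * dS (s 0 0) b hab * uS M ^ (s 0 1 * b).val := by
  haveI : NeZero (2 ^ (M + 1)) := ⟨pow_ne_zero _ two_ne_zero⟩
  have hdet : s 0 0 * s 1 1 - s 0 1 * s 1 0 = 1 := by
    have := s.2; rw [Matrix.det_fin_two] at this; exact this
  apply Matrix.SpecialLinearGroup.ext
  have hR : ((lS M ^ (s 1 0 * b).val * dS (s 0 0) b hab * uS M ^ (s 0 1 * b).val :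
      SL(2, ZMod (2 ^ (M + 1)))) : Matrix (Fin 2) (Fin 2) (ZMod (2 ^ (M + 1)))) =
      !![s 0 0, s 0 0 * (s 0 1 * b); s 1 0 * b * s 0 0, s 1 0 * b * s 0 0 * (s 0 1 * b) + b] := by
    rw [Matrix.SpecialLinearGroup.coe_mul, Matrix.SpecialLinearGroup.coe_mul, coe_lS_pow, coe_uS_pow, coe_dS,
      ZMod.natCast_zmod_val, ZMod.natCast_zmod_val, Matrix.mul_fin_two, Matrix.mul_fin_two]
    (congr 1; simp)
  intro i j
  rw [hR]
  fin_cases i <;> fin_cases j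
  · simp
  · simp; linear_combination (-(s 0 1)) * hab
  · simp; linear_combination (-(s 1 0)) * hab
  · simp; linear_combination b * hdet - (s 1 1 + s 0 1 * s 1 0 * b) * hab

/-! ### parity bookkeeping in `ZMod 2` (finite checks) -/

/-- Finite check in `ZMod 2`: with a unit pivot the determinant relation fixes the remaining parities. [folklore] -/
theorem zmod2_key_unit : ∀ p q t00 t11 tb : ZMod 2, t00 * tb = 1 → t00 * t11 - p * q = 1 →
    ((t00 + t11 = 0 ∧ (p ≠ 0 ∨ q ≠ 0)) ↔ q * tb + p * tb ≠ 0) := by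
  decide

/-- Finite check in `ZMod 2`: a non-unit pivot forces the off-diagonal entries to be units. [folklore] -/
theorem zmod2_key_nonunit : ∀ t00 t01 t10 t11 : ZMod 2, t00 = 0 → t00 * t11 - t01 * t10 = 1 →
    ((t00 + t11 = 0 ∧ (t01 ≠ 0 ∨ t10 ≠ 0)) ↔ ¬ ((t00 + t10) + t11 = 0 ∧ (t01 + t11 ≠ 0 ∨ t10 ≠ 0))) := by
  decide

/-- In `ZMod 2`, `t ≠ 0 ↔ t = 1`. [folklore] -/
theorem zmod2_ne_zero_iff : ∀ t : ZMod 2, t ≠ 0 ↔ t = 1 := by decide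

/-- If `x² = 1` then `x^n` is `1` or `x` according to the parity of `n`. [folklore] -/
theorem pow_eq_ite_of_sq {A : Type*} [Monoid A] (x : A) (hx : x ^ 2 = 1) (n : ℕ) :
    x ^ n = if Even n then 1 else x := by
  rcases Nat.even_or_odd n with h | h
  · obtain ⟨k, rfl⟩ := h
    rw [if_pos (by exact ⟨k, rfl⟩), ← two_mul, pow_mul, hx, one_pow]
  · obtain ⟨k, rfl⟩ := h
    rw [if_neg (by exact Nat.not_even_iff_odd.mpr ⟨k, rfl⟩), pow_succ, pow_mul, hx, one_pow, one_mul]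

/-- The determinant relation `s₀₀ s₁₁ − s₀₁ s₁₀ = 1` for `s ∈ SL₂`. [folklore] -/
theorem det_entries (s : SL(2, ZMod (2 ^ (M + 1)))) : s 0 0 * s 1 1 - s 0 1 * s 1 0 = 1 := by
  have := s.2; rw [Matrix.det_fin_two] at this; exact this

section Char

variable {A : Type*} [CommGroup A]

/-- UNIT-PIVOT CASE. -/
theorem char_eq_of_pivot (χ : SL(2, ZMod (2 ^ (M + 1))) →* A)
    (hlu : χ (lS M) = χ (uS M)) (hd : ∀ a b hab, χ (dS (M := M) a b hab) = 1) (h2 : χ (uS M) ^ 2 = 1)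
    (s : SL(2, ZMod (2 ^ (M + 1)))) (b : ZMod (2 ^ (M + 1))) (hab : s 0 0 * b = 1) :
    χ s = if OddModTwo s then χ (uS M) else 1 := by
  haveI : NeZero (2 ^ (M + 1)) := ⟨pow_ne_zero _ two_ne_zero⟩
  have hdet := det_entries s
  have hχ : χ s = χ (uS M) ^ ((s 1 0 * b).val + (s 0 1 * b).val) := by
    have e := congrArg χ (ldu s b hab)
    rw [map_mul, map_mul, map_pow, map_pow, hlu, hd, mul_one, ← pow_add] at e
    exact e
  rw [hχ, pow_eq_ite_of_sq _ h2]
  -- parity bookkeeping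
  have hπdet : redTwo M (s 0 0) * redTwo M (s 1 1) - redTwo M (s 0 1) * redTwo M (s 1 0) = 1 := by
    have := congrArg (redTwo M) hdet; simpa using this
  have hπab : redTwo M (s 0 0) * redTwo M b = 1 := by
    have := congrArg (redTwo M) hab; simpa using this
  have hkey := zmod2_key_unit (redTwo M (s 0 1)) (redTwo M (s 1 0)) (redTwo M (s 0 0)) (redTwo M (s 1 1)) (redTwo M b) hπab hπdet
  have hcast : (((s 1 0 * b).val + (s 0 1 * b).val : ℕ) : ZMod 2) = redTwo M (s 1 0) * redTwo M b + redTwo M (s 0 1) * redTwo M b := by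
    push_cast
    rw [← redTwo_eq_natCast_val, ← redTwo_eq_natCast_val, map_mul, map_mul]
  have hodd : OddModTwo s ↔ ¬ Even ((s 1 0 * b).val + (s 0 1 * b).val) := by
    rw [← ZMod.natCast_eq_zero_iff_even, hcast]
    unfold OddModTwo
    rw [map_add]
    exact hkey
  by_cases h : OddModTwo s
  · rw [if_pos h, if_neg (hodd.mp h)]
  · rw [if_neg h, if_pos (by simpa [hodd] using h)]

/-- GENERAL CASE on `SL₂(ℤ/2^(M+1))`. -/
theorem char_eq (χ : SL(2, ZMod (2 ^ (M + 1))) →* A)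
    (hlu : χ (lS M) = χ (uS M)) (hd : ∀ a b hab, χ (dS (M := M) a b hab) = 1) (h2 : χ (uS M) ^ 2 = 1)
    (s : SL(2, ZMod (2 ^ (M + 1)))) :
    χ s = if OddModTwo s then χ (uS M) else 1 := by
  haveI : NeZero (2 ^ (M + 1)) := ⟨pow_ne_zero _ two_ne_zero⟩
  by_cases hu : IsUnit (s 0 0)
  · obtain ⟨b, hab⟩ := hu.exists_right_inv
    exact char_eq_of_pivot χ hlu hd h2 s b hab
  · -- pivot on `u * s`, whose `(0,0)` entry `s₀₀ + s₁₀` is a unit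
    have hdet := det_entries s
    have h00 : redTwo M (s 0 0) = 0 := (redTwo_eq_zero_iff_not_isUnit _).mpr hu
    have hπdet : redTwo M (s 0 0) * redTwo M (s 1 1) - redTwo M (s 0 1) * redTwo M (s 1 0) = 1 := by
      have := congrArg (redTwo M) hdet; simpa using this
    set s' : SL(2, ZMod (2 ^ (M + 1))) := uS M * s with hs'
    have e00 : s' 0 0 = s 0 0 + s 1 0 := by
      simp [hs', Matrix.SpecialLinearGroup.coe_mul, Matrix.mul_apply, Fin.sum_univ_two]
    have e01 : s' 0 1 = s 0 1 + s 1 1 := by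
      simp [hs', Matrix.SpecialLinearGroup.coe_mul, Matrix.mul_apply, Fin.sum_univ_two]
    have e10 : s' 1 0 = s 1 0 := by
      simp [hs', Matrix.SpecialLinearGroup.coe_mul, Matrix.mul_apply, Fin.sum_univ_two]
    have e11 : s' 1 1 = s 1 1 := by
      simp [hs', Matrix.SpecialLinearGroup.coe_mul, Matrix.mul_apply, Fin.sum_univ_two]
    have hu' : IsUnit (s' 0 0) := by
      rw [isUnit_iff_redTwo_eq_one, e00, map_add, h00, zero_add]
      have h10 : redTwo M (s 1 0) ≠ 0 := by
        intro h10
        rw [h00, h10] at hπdet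
        simp at hπdet
      exact (zmod2_ne_zero_iff _).mp h10
    obtain ⟨b, hab⟩ := hu'.exists_right_inv
    have hs'χ := char_eq_of_pivot χ hlu hd h2 s' b hab
    have hss : χ s = χ (uS M)⁻¹ * χ s' := by rw [hs', ← map_mul, inv_mul_cancel_left]
    have hodd : OddModTwo s ↔ ¬ OddModTwo s' := by
      unfold OddModTwo
      rw [e00, e01, e10, e11, map_add, map_add, map_add, map_add]
      exact zmod2_key_nonunit _ _ _ _ h00 hπdet
    have hinv : χ (uS M)⁻¹ = χ (uS M) := by
      rw [map_inv, inv_eq_iff_mul_eq_one, ← pow_two, h2]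
    rw [hss, hs'χ]
    by_cases h : OddModTwo s
    · rw [if_pos h, if_neg (hodd.mp h), mul_one, hinv]
    · rw [if_neg h, if_pos (by simpa [hodd] using h), hinv, ← pow_two, h2]

/-- Corollary: a character as above with `χ(u) = 1` is trivial on `SL₂`. -/
theorem char_eq_one (χ : SL(2, ZMod (2 ^ (M + 1))) →* A)
    (hlu : χ (lS M) = χ (uS M)) (hd : ∀ a b hab, χ (dS (M := M) a b hab) = 1) (hu : χ (uS M) = 1)
    (s : SL(2, ZMod (2 ^ (M + 1)))) : χ s = 1 := by
  rw [char_eq χ hlu hd (by rw [hu, one_pow]) s, hu, ite_self]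

end Char

/-! ### From a character of `GL₂(ℤ/2^(M+1))`: the two hypotheses `hlu`, `hd` are automatic -/

section GLChar

variable {A : Type*} [CommGroup A]

/-- `J = [[0,1],[1,0]]` as a unit (`J² = 1`). -/
def Jmat (M : ℕ) : Matrix (Fin 2) (Fin 2) (ZMod (2 ^ (M + 1))) := !![0, 1; 1, 0]

/-- `J² = 1` for `J = [[0,1],[1,0]]`. [folklore] -/
theorem Jmat_mul_Jmat : Jmat M * Jmat M = 1 := by
  rw [Jmat, Matrix.mul_fin_two, Matrix.one_fin_two]
  (congr 1; simp)

/-- `J = [[0,1],[1,0]]` as an element of `GL₂(ℤ/2^{M+1})`. -/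
def JGL (M : ℕ) : GL (Fin 2) (ZMod (2 ^ (M + 1))) :=
  ⟨Jmat M, Jmat M, Jmat_mul_Jmat, Jmat_mul_Jmat⟩

/-- `diag(a, 1)` as a unit, for `a b = 1`. -/
def diagGL (a b : ZMod (2 ^ (M + 1))) (hab : a * b = 1) : GL (Fin 2) (ZMod (2 ^ (M + 1))) :=
  ⟨!![a, 0; 0, 1], !![b, 0; 0, 1],
    by rw [Matrix.mul_fin_two, Matrix.one_fin_two]; (congr 1; simp [hab]),
    by rw [Matrix.mul_fin_two, Matrix.one_fin_two]; (congr 1; simp [mul_comm b a, hab])⟩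

/-- `l = J u J` in `GL₂`. [folklore] -/
theorem toGL_lS_eq : Matrix.SpecialLinearGroup.toGL (lS M) = JGL M * Matrix.SpecialLinearGroup.toGL (uS M) * JGL M := by
  apply Units.ext
  change ((lS M : SL(2, ZMod (2 ^ (M + 1)))) : Matrix (Fin 2) (Fin 2) (ZMod (2 ^ (M + 1)))) =
    Jmat M * ((uS M : SL(2, ZMod (2 ^ (M + 1)))) : Matrix (Fin 2) (Fin 2) (ZMod (2 ^ (M + 1)))) * Jmat M
  rw [coe_lS, coe_uS, Jmat, Matrix.mul_fin_two, Matrix.mul_fin_two]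
  (congr 1; simp)

/-- `diag(a, b) = diag(a,1) · J · diag(b,1) · J` in `GL₂` (for `ab = 1`). [folklore] -/
theorem toGL_dS_eq (a b : ZMod (2 ^ (M + 1))) (hab : a * b = 1) :
    Matrix.SpecialLinearGroup.toGL (dS a b hab) = diagGL a b hab * JGL M * (diagGL a b hab)⁻¹ * JGL M := by
  apply Units.ext
  change ((dS a b hab : SL(2, ZMod (2 ^ (M + 1)))) : Matrix (Fin 2) (Fin 2) (ZMod (2 ^ (M + 1)))) =
    !![a, 0; 0, 1] * Jmat M * !![b, 0; 0, 1] * Jmat M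
  rw [coe_dS, Jmat, Matrix.mul_fin_two, Matrix.mul_fin_two, Matrix.mul_fin_two]
  (congr 1; simp)

/-- `J² = 1` in `GL₂`. [folklore] -/
theorem JGL_mul_JGL : JGL M * JGL M = 1 := Units.ext (Jmat_mul_Jmat (M := M))

/-- **E1a (GL form).** For every homomorphism `ψ : GL₂(ℤ/2^(M+1)) → A` to a commutative group with `ψ(u)² = 1`,
and every `s ∈ SL₂(ℤ/2^(M+1))`: `ψ(s) = ψ(u)` if `s mod 2` is a transposition of `SL₂(𝔽₂) ≅ S₃`, and `ψ(s) = 1` otherwise.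
In words: `ψ|_{SL₂} ∈ {1, sgn ∘ (mod 2)}`. -/
theorem charGL_eq (ψ : GL (Fin 2) (ZMod (2 ^ (M + 1))) →* A)
    (h2 : ψ (Matrix.SpecialLinearGroup.toGL (uS M)) ^ 2 = 1) (s : SL(2, ZMod (2 ^ (M + 1)))) :
    ψ (Matrix.SpecialLinearGroup.toGL s) =
      if OddModTwo s then ψ (Matrix.SpecialLinearGroup.toGL (uS M)) else 1 := by
  have hlu : (ψ.comp Matrix.SpecialLinearGroup.toGL) (lS M) = (ψ.comp Matrix.SpecialLinearGroup.toGL) (uS M) := by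
    rw [MonoidHom.comp_apply, MonoidHom.comp_apply, toGL_lS_eq, map_mul, map_mul, mul_right_comm, ← map_mul,
      JGL_mul_JGL, map_one, one_mul]
  have hd : ∀ a b hab, (ψ.comp Matrix.SpecialLinearGroup.toGL) (dS (M := M) a b hab) = 1 := by
    intro a b hab
    rw [MonoidHom.comp_apply, toGL_dS_eq, map_mul, map_mul, map_mul, map_inv, mul_right_comm (ψ (diagGL a b hab)),
      mul_inv_cancel, one_mul, ← map_mul, JGL_mul_JGL, map_one]
  exact char_eq (ψ.comp Matrix.SpecialLinearGroup.toGL) hlu hd h2 s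

/-- Corollary: `ψ(u) = 1` forces `ψ` to be trivial on `SL₂(ℤ/2^(M+1))`, i.e. `ψ` factors through `det`. -/
theorem charGL_eq_one (ψ : GL (Fin 2) (ZMod (2 ^ (M + 1))) →* A)
    (hu : ψ (Matrix.SpecialLinearGroup.toGL (uS M)) = 1) (s : SL(2, ZMod (2 ^ (M + 1)))) :
    ψ (Matrix.SpecialLinearGroup.toGL s) = 1 := by
  rw [charGL_eq ψ (by rw [hu, one_pow]) s, hu, ite_self]

/-- Corollary: on the kernel of reduction mod `2` (inside `SL₂`), every such `ψ` is trivial. -/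
theorem charGL_eq_one_of_reduction_eq_one (ψ : GL (Fin 2) (ZMod (2 ^ (M + 1))) →* A)
    (h2 : ψ (Matrix.SpecialLinearGroup.toGL (uS M)) ^ 2 = 1) (s : SL(2, ZMod (2 ^ (M + 1))))
    (h01 : redTwo M (s 0 1) = 0) (h10 : redTwo M (s 1 0) = 0) :
    ψ (Matrix.SpecialLinearGroup.toGL s) = 1 := by
  rw [charGL_eq ψ h2 s, if_neg]
  unfold OddModTwo
  rw [h01, h10]
  simp

/-- Corollary: if `ψ(u) = 1` then `ψ` factors through `det`: `det g = det h ⟹ ψ g = ψ h`. -/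
theorem charGL_eq_of_det_eq (ψ : GL (Fin 2) (ZMod (2 ^ (M + 1))) →* A)
    (hu : ψ (Matrix.SpecialLinearGroup.toGL (uS M)) = 1) (g h : GL (Fin 2) (ZMod (2 ^ (M + 1))))
    (hdet : Matrix.GeneralLinearGroup.det g = Matrix.GeneralLinearGroup.det h) : ψ g = ψ h := by
  have hd1 : ((g * h⁻¹ : GL (Fin 2) (ZMod (2 ^ (M + 1)))) : Matrix (Fin 2) (Fin 2) (ZMod (2 ^ (M + 1)))).det = 1 := by
    have h1 : Matrix.GeneralLinearGroup.det (g * h⁻¹) = 1 := by rw [map_mul, map_inv, hdet, mul_inv_cancel]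
    have h2 := congrArg (fun u : (ZMod (2 ^ (M + 1)))ˣ ↦ (u : ZMod (2 ^ (M + 1)))) h1
    simpa [Matrix.GeneralLinearGroup.val_det_apply] using h2
  set s : SL(2, ZMod (2 ^ (M + 1))) := ⟨((g * h⁻¹ : GL (Fin 2) (ZMod (2 ^ (M + 1)))) : Matrix (Fin 2) (Fin 2) (ZMod (2 ^ (M + 1)))), hd1⟩ with hs
  have hsg : Matrix.SpecialLinearGroup.toGL s = g * h⁻¹ := Units.ext rfl
  calc ψ g = ψ (g * h⁻¹) * ψ h := by rw [map_mul, map_inv, inv_mul_cancel_right]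
    _ = ψ (Matrix.SpecialLinearGroup.toGL s) * ψ h := by rw [hsg]
    _ = ψ h := by rw [charGL_eq_one ψ hu s, one_mul]

/-- Corollary: in general (`ψ(u)² = 1`), for `det g = det h`: `ψ g = ψ h` unless `g h⁻¹` is ODD mod `2`, in which case they
differ by `ψ(u)`. -/
theorem charGL_mul_inv_eq (ψ : GL (Fin 2) (ZMod (2 ^ (M + 1))) →* A)
    (h2 : ψ (Matrix.SpecialLinearGroup.toGL (uS M)) ^ 2 = 1) (g h : GL (Fin 2) (ZMod (2 ^ (M + 1))))
    (hdet : Matrix.GeneralLinearGroup.det g = Matrix.GeneralLinearGroup.det h)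
    (hd1 : ((g * h⁻¹ : GL (Fin 2) (ZMod (2 ^ (M + 1)))) : Matrix (Fin 2) (Fin 2) (ZMod (2 ^ (M + 1)))).det = 1) :
    ψ g = (if OddModTwo (⟨((g * h⁻¹ : GL (Fin 2) (ZMod (2 ^ (M + 1)))) : Matrix (Fin 2) (Fin 2) (ZMod (2 ^ (M + 1)))), hd1⟩ :
              SL(2, ZMod (2 ^ (M + 1)))) then ψ (Matrix.SpecialLinearGroup.toGL (uS M)) else 1) * ψ h := by
  set s : SL(2, ZMod (2 ^ (M + 1))) := ⟨((g * h⁻¹ : GL (Fin 2) (ZMod (2 ^ (M + 1)))) : Matrix (Fin 2) (Fin 2) (ZMod (2 ^ (M + 1)))), hd1⟩ with hs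
  have hsg : Matrix.SpecialLinearGroup.toGL s = g * h⁻¹ := Units.ext rfl
  have _hdet := hdet
  calc ψ g = ψ (g * h⁻¹) * ψ h := by rw [map_mul, map_inv, inv_mul_cancel_right]
    _ = ψ (Matrix.SpecialLinearGroup.toGL s) * ψ h := by rw [hsg]
    _ = _ := by rw [charGL_eq ψ h2 s]

end GLChar

end SL

end ParityB

end Summit.BirchSwinnertonDyer.BirchSwinnertonDyer.Theorems.OffBigImageOddLocalAtTwo.Engine

end
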